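import Literature.NumberTheory.EllipticCurves.KubertTateFiveGaussianTwistShaCriterion
import Literature.NumberTheory.EllipticCurves.KubertTateM919ShaFive
import Literature.NumberTheory.EllipticCurves.LocalReductionKrausMinimality
import Literature.NumberTheory.EllipticCurves.ComplexMultiplicationLocalFactorsAux
import Literature.NumberTheory.EllipticCurves.LutzNagellGeneralWeierstrass
import Literature.NumberTheory.EllipticCurves.OrdinaryPrimesProofs
import Literature.NumberTheory.EllipticCurves.RationalPointInfiniteOrderCriteria
import Mathlib.Tactic.NormNum.Prime
import HarnessLib

/-!
# The twist `E_{-91/9}^{(-4)} = [0, −13276, 0, 5896800, −869306256]`: trivial torsion, RANK `1`, `t₅ = 0` — by the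
# class-wide Gaussian criterion (the rank attains `ω₁ = 1`), no `ℤ[i]`-valuation table needed

PROOF-ONLY file (theorems only, no definition, no named fact, no `sorry`), topic `NumberTheory/EllipticCurves`; the third row of
the Gaussian-twist table and the first produced by the CHEAP route: `KubertTateFiveGaussianTwistShaCriterion.twist_door_of_le_rank`
(Gaussian-tame `E_{m,n}`, full `ℚ`-box, `rank E^{(-4)}(ℚ) ≥ ω₁(mn)` ⟹ `t₅(E^{(-4)}) = 0`, `rank E^{(-4)} = ω₁(mn)`) only asks for
`ω₁(mn)` independent points ON THE TWIST over `ℚ` — here one point of infinite order.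

`E = E_{-91/9} = [100, 819, 7371, 0, 0]` (tree `KubertTateM919Descent`: rank `2`, box full, Gaussian-tame, `mn = -3²·7·13`,
`ω₁ = 1`).  The twist model `W = E^{(-4)} = [0, −13276, 0, 5896800, −869306256]` (`quadraticTwist (-4)`) carries the rational point
`P = (48061, 8979477)` (from `(u, Y) = (-48061/4, 8979477/4)` on `Y² = −g(u)`: `(x, y) = (−4u, 4Y)`); `W` is globally minimal
(Kraus at `2`, `q¹² ∤ Δ = −2¹²·3¹⁰·7⁵·13⁵·17209` for odd `q`); `#W̃(𝔽₅) = 5`, `#W̃(𝔽₁₁) = 14`, so `W(ℚ)_tors = 0`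
(`#W(ℚ)_tors ∣ gcd(5, 14)`), `3 ∣ den x(2P)` so `P` has infinite order (Lutz–Nagell at `3`) and `rank W(ℚ) ≥ 1 = ω₁`.  Hence (`twist_M91_9`):
**`rank E_{-91/9}^{(-4)}(ℚ) = 1`, `t₅(E_{-91/9}^{(-4)}/ℚ) = 0`, `t₅(E_{-91/9}/ℚ) = 0`**; and `a₅(W) = 1`, `5` good ordinary
(`goodOrdinary_five_twist`).  Transfer statement T (stmt-22356) instrument; BSD is not proved by this.

## References

* [SilvermanAEC2009] J. H. Silverman, *AEC*, 2nd ed., VII.1 Remark 1.1, VII.5 Prop. 5.1, VIII.6.7, X.§2, Exercise 10.16.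
* [Kraus1989] A. Kraus, *Quelques remarques à propos des invariants c₄, c₆ et Δ d'une courbe elliptique*, Prop. 2.
* [Knapp1993] A. W. Knapp, *Elliptic Curves*, Ch. V §1 Thm. 5.1(c).
* [Fisher2001FiveSevenDescent] T. Fisher, JEMS 3 (2001), §§1–2.
-/

noncomputable section

open scoped Classical
open WeierstrassCurve Literature.NumberTheory.EllipticCurves
open Literature.NumberTheory.EllipticCurves.Rank1Residual.X11RankOneCertificates (discOf c4Of c6Of)

namespace Literature.NumberTheory.EllipticCurves

namespace KubertTateM919GaussianTwist

/-! ## §1 The twist model, its rational point, global minimality -/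

/-- **`E_{-91/9}^{(-4)} = [0, −13276, 0, 5896800, −869306256]`** (`b₂ = 13276`, `b₄ = 737100`, `b₆ = 54331641`).
[cite: SilvermanAEC2009, X.§2] -/
theorem twist_eq : (kubertTateFive (((-91 : ℤ) : ℚ)) (((9 : ℤ) : ℚ))).quadraticTwist (-4) =
    (⟨((0 : ℤ) : ℚ), ((-13276 : ℤ) : ℚ), ((0 : ℤ) : ℚ), ((5896800 : ℤ) : ℚ), ((-869306256 : ℤ) : ℚ)⟩ : WeierstrassCurve ℚ) := by
  rw [KubertTateM919Descent.curve_eq]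
  ext <;> simp [quadraticTwist, WeierstrassCurve.b₂, WeierstrassCurve.b₄, WeierstrassCurve.b₆] <;> norm_num

/-- The twist is elliptic (`-4 ≠ 0`). [cite: SilvermanAEC2009, X.§2] -/
theorem isElliptic_twist :
    haveI := KubertTateM919Descent.isElliptic
    ((kubertTateFive (((-91 : ℤ) : ℚ)) (((9 : ℤ) : ℚ))).quadraticTwist (-4)).IsElliptic := by
  haveI := KubertTateM919Descent.isElliptic
  exact isElliptic_quadraticTwist _ (by norm_num)

/-- **The rational point `P = (48061, 8979477)` of the twist** (`(−4u, 4Y)` for the twist point `(u, Y) = (−48061/4, 8979477/4)`).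
[cite: SilvermanAEC2009, X.§2] -/
theorem nonsingular_P :
    ((kubertTateFive (((-91 : ℤ) : ℚ)) (((9 : ℤ) : ℚ))).quadraticTwist (-4)).toAffine.Nonsingular 48061 8979477 := by
  haveI := isElliptic_twist
  rw [← Affine.equation_iff_nonsingular, twist_eq, Affine.equation_iff]
  push_cast
  norm_num

/-- `Δ`, `c₄`, `c₆` of the integer model (kernel evaluation). [folklore] -/
private theorem invariants_model :
    discOf [0, -13276, 0, 5896800, -869306256] = -25973776032014105358336 ∧
    c4Of [0, -13276, 0, 5896800, -869306256] = 2536988416 ∧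
    c6Of [0, -13276, 0, 5896800, -869306256] = 127959865435648 := by
  refine ⟨?_, ?_, ?_⟩ <;> decide

/-- **The twist model is globally minimal** (Kraus's test at `2`: `2²⁴ ∤ Δ`, `2¹¹ ∤ c₆`, `2¹¹ ∤ c₆ − 2⁹`, `2⁸ ∤ c₆ + 2⁶`;
`q¹² ∤ Δ = −2¹²·3¹⁰·7⁵·13⁵·17209` for odd `q`). [cite: Kraus1989, Prop. 2] [cite: SilvermanAEC2009, VII.1 Remark 1.1 and VIII.8] -/
theorem isGloballyMinimal_model :
    (⟨((0 : ℤ) : ℚ), ((-13276 : ℤ) : ℚ), ((0 : ℤ) : ℚ), ((5896800 : ℤ) : ℚ), ((-869306256 : ℤ) : ℚ)⟩ :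
      WeierstrassCurve ℚ).IsGloballyMinimal := by
  obtain ⟨hD, hc4, hc6⟩ := invariants_model
  refine WeierstrassCurve.isGloballyMinimal_of_int_kraus 0 (-13276) 0 5896800 (-869306256) fun q hq ↦ ?_
  rcases eq_or_ne q 2 with rfl | h2
  · refine Or.inr (Or.inl ⟨rfl, ?_, ?_, ?_⟩)
    · rw [hD]; norm_num
    · rw [hc4, hc6]; norm_num
    · rw [hc6]; norm_num
  · refine Or.inl fun h ↦ ?_
    obtain ⟨h12, -⟩ := h
    rw [hD] at h12
    have hq1 : (q : ℤ) ∣ 25973776032014105358336 := Int.dvd_neg.mp (dvd_trans (dvd_pow_self _ (by norm_num)) h12)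
    have hdvdN : q ∣ 2 ^ 12 * 3 ^ 10 * 7 ^ 5 * 13 ^ 5 * 17209 := by
      have e : ((2 ^ 12 * 3 ^ 10 * 7 ^ 5 * 13 ^ 5 * 17209 : ℕ) : ℤ) = 25973776032014105358336 := by norm_num
      exact Int.natCast_dvd_natCast.mp (e ▸ hq1)
    have hpi := Nat.Prime.prime hq
    rcases hpi.dvd_or_dvd hdvdN with h | h
    · rcases hpi.dvd_or_dvd h with h | h
      · rcases hpi.dvd_or_dvd h with h | h
        · rcases hpi.dvd_or_dvd h with h | h
          · exact h2 ((Nat.prime_dvd_prime_iff_eq hq Nat.prime_two).mp (hpi.dvd_of_dvd_pow h))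
          · have := (Nat.prime_dvd_prime_iff_eq hq Nat.prime_three).mp (hpi.dvd_of_dvd_pow h)
            subst this; revert h12; norm_num
        · have := (Nat.prime_dvd_prime_iff_eq hq (by norm_num : Nat.Prime 7)).mp (hpi.dvd_of_dvd_pow h)
          subst this; revert h12; norm_num
      · have := (Nat.prime_dvd_prime_iff_eq hq (by norm_num : Nat.Prime 13)).mp (hpi.dvd_of_dvd_pow h)
        subst this; revert h12; norm_num
    · have := (Nat.prime_dvd_prime_iff_eq hq (by norm_num : Nat.Prime 17209)).mp h
      subst this; revert h12; norm_num

/-- The twist `E_{-91/9}^{(-4)}` is globally minimal. [cite: Kraus1989, Prop. 2] [cite: SilvermanAEC2009, VIII.8] -/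
theorem isGloballyMinimal_twist :
    ((kubertTateFive (((-91 : ℤ) : ℚ)) (((9 : ℤ) : ℚ))).quadraticTwist (-4)).IsGloballyMinimal := by
  rw [twist_eq]; exact isGloballyMinimal_model

/-- The tree's integral model of the twist is the integer equation. [cite: SilvermanAEC2009, VIII.8] -/
theorem integralModelInt_twist :
    haveI := isGloballyMinimal_twist
    integralModelInt ((kubertTateFive (((-91 : ℤ) : ℚ)) (((9 : ℤ) : ℚ))).quadraticTwist (-4)) =
      ⟨0, -13276, 0, 5896800, -869306256⟩ := by
  haveI := isGloballyMinimal_twist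
  apply WeierstrassCurve.map_injective (f := Int.castRingHom ℚ) Int.cast_injective
  beta_reduce
  rw [map_integralModelInt, twist_eq]
  ext <;> simp [WeierstrassCurve.map]

/-! ## §2 Reduction at `5` and `11`: `#W̃(𝔽₅) = 5`, `#W̃(𝔽₁₁) = 14`; trivial torsion; `a₅ = 1` -/

/-- The reductions of the integer model modulo `5` and `11`. [folklore] -/
private theorem map_zmod :
    (⟨0, -13276, 0, 5896800, -869306256⟩ : WeierstrassCurve ℤ).map (Int.castRingHom (ZMod 5)) =
        (⟨0, 4, 0, 0, 4⟩ : WeierstrassCurve (ZMod 5)) ∧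
      (⟨0, -13276, 0, 5896800, -869306256⟩ : WeierstrassCurve ℤ).map (Int.castRingHom (ZMod 11)) =
        (⟨0, 1, 0, 8, 6⟩ : WeierstrassCurve (ZMod 11)) := by
  constructor <;> (ext <;> simp [WeierstrassCurve.map] <;> decide)

/-- **`#W̃(𝔽₅) = 5`** (`y² = x³ + 4x² + 4` over `𝔽₅`: `4` affine points and `O`). [cite: SilvermanAEC2009, V.2] -/
theorem natCard_point_five :
    Nat.card (((⟨0, -13276, 0, 5896800, -869306256⟩ : WeierstrassCurve ℤ).map
      (Int.castRingHom (ZMod 5))).toAffine.Point) = 5 := by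
  rw [map_zmod.1, natCard_point_eq_one_add_card (F := ZMod 5) _ (by decide)]
  have h : Fintype.card {xy : ZMod 5 × ZMod 5 //
      xy.2 ^ 2 + (⟨0, 4, 0, 0, 4⟩ : WeierstrassCurve (ZMod 5)).a₁ * xy.1 * xy.2 +
        (⟨0, 4, 0, 0, 4⟩ : WeierstrassCurve (ZMod 5)).a₃ * xy.2 =
      xy.1 ^ 3 + (⟨0, 4, 0, 0, 4⟩ : WeierstrassCurve (ZMod 5)).a₂ * xy.1 ^ 2 +
        (⟨0, 4, 0, 0, 4⟩ : WeierstrassCurve (ZMod 5)).a₄ * xy.1 + (⟨0, 4, 0, 0, 4⟩ : WeierstrassCurve (ZMod 5)).a₆} = 4 := by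
    decide +kernel
  rw [h]

/-- **`#W̃(𝔽₁₁) = 14`** (`y² = x³ + x² + 8x + 6` over `𝔽₁₁`: `13` affine points and `O`). [cite: SilvermanAEC2009, V.2] -/
theorem natCard_point_eleven :
    Nat.card (((⟨0, -13276, 0, 5896800, -869306256⟩ : WeierstrassCurve ℤ).map
      (Int.castRingHom (ZMod 11))).toAffine.Point) = 14 := by
  rw [map_zmod.2, natCard_point_eq_one_add_card (F := ZMod 11) _ (by decide)]
  have h : Fintype.card {xy : ZMod 11 × ZMod 11 //
      xy.2 ^ 2 + (⟨0, 1, 0, 8, 6⟩ : WeierstrassCurve (ZMod 11)).a₁ * xy.1 * xy.2 +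
        (⟨0, 1, 0, 8, 6⟩ : WeierstrassCurve (ZMod 11)).a₃ * xy.2 =
      xy.1 ^ 3 + (⟨0, 1, 0, 8, 6⟩ : WeierstrassCurve (ZMod 11)).a₂ * xy.1 ^ 2 +
        (⟨0, 1, 0, 8, 6⟩ : WeierstrassCurve (ZMod 11)).a₄ * xy.1 + (⟨0, 1, 0, 8, 6⟩ : WeierstrassCurve (ZMod 11)).a₆} = 13 := by
    decide +kernel
  rw [h]

/-- The integer discriminant of the twist model. [folklore] -/
private theorem Δ_model : (⟨0, -13276, 0, 5896800, -869306256⟩ : WeierstrassCurve ℤ).Δ = -25973776032014105358336 := by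
  norm_num [WeierstrassCurve.Δ, WeierstrassCurve.b₂, WeierstrassCurve.b₄, WeierstrassCurve.b₆, WeierstrassCurve.b₈]

/-- **`E_{-91/9}^{(-4)}(ℚ)_tors = 0`**: `#W(ℚ)_tors` divides `#W̃(𝔽₅) = 5` and `#W̃(𝔽₁₁) = 14` (reduction of torsion at the good
primes `5, 11`, `a₁ = 0`; tree `torsionOrder_dvd_reductionPointCount`). [cite: Knapp1993, Ch. V §1 Thm. 5.1(c)] -/
theorem torsionOrder_twist_eq_one :
    haveI := isElliptic_twist
    ((kubertTateFive (((-91 : ℤ) : ℚ)) (((9 : ℤ) : ℚ))).quadraticTwist (-4)).torsionOrder = 1 := by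
  haveI := isElliptic_twist
  haveI := isGloballyMinimal_twist
  haveI : Fact (Nat.Prime 5) := ⟨Nat.prime_five⟩
  haveI : Fact (Nat.Prime 11) := ⟨by norm_num⟩
  have h5 := LutzNagellGeneral.torsionOrder_dvd_reductionPointCount
    ((kubertTateFive (((-91 : ℤ) : ℚ)) (((9 : ℤ) : ℚ))).quadraticTwist (-4)) 5 (Or.inl (by decide))
    (by rw [minimalDiscriminantInt, integralModelInt_twist, Δ_model]; norm_num)
  have h11 := LutzNagellGeneral.torsionOrder_dvd_reductionPointCount
    ((kubertTateFive (((-91 : ℤ) : ℚ)) (((9 : ℤ) : ℚ))).quadraticTwist (-4)) 11 (Or.inl (by decide))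
    (by rw [minimalDiscriminantInt, integralModelInt_twist, Δ_model]; norm_num)
  rw [WeierstrassCurve.reductionPointCount, integralModelInt_twist] at h5 h11
  rw [natCard_point_five] at h5
  rw [natCard_point_eleven] at h11
  have h1 : ((kubertTateFive (((-91 : ℤ) : ℚ)) (((9 : ℤ) : ℚ))).quadraticTwist (-4)).torsionOrder ∣ Nat.gcd 5 14 :=
    Nat.dvd_gcd h5 h11
  exact Nat.dvd_one.mp (by simpa using h1)

/-- **The rational point `2P = (185866503817345/11292462756, 1174894244419572097577/1200004847229096)` of the twist**
(`den x(2P) = (2·3·89·199)²`). [cite: SilvermanAEC2009, III.2.3] -/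
theorem nonsingular_twoP :
    ((kubertTateFive (((-91 : ℤ) : ℚ)) (((9 : ℤ) : ℚ))).quadraticTwist (-4)).toAffine.Nonsingular
      (185866503817345 / 11292462756) (1174894244419572097577 / 1200004847229096) := by
  haveI := isElliptic_twist
  rw [← Affine.equation_iff_nonsingular, twist_eq, Affine.equation_iff]
  push_cast
  norm_num

/-- **`rank E_{-91/9}^{(-4)}(ℚ) ≥ 1`**: the rational point `2P` has `3 ∣ den x(2P)`, so it has infinite order (Lutz–Nagell /
AEC VII.3.4 at the odd prime `3` on the globally minimal model; tree `one_le_mordellWeilRank_of_dvd_den`) and Mordell–Weil gives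
`rank ≥ 1`. [cite: SilvermanAEC2009, VII.3.4 and Thm. VIII.6.7] -/
theorem one_le_mordellWeilRank_twist :
    haveI := isElliptic_twist
    1 ≤ ((kubertTateFive (((-91 : ℤ) : ℚ)) (((9 : ℤ) : ℚ))).quadraticTwist (-4)).mordellWeilRank := by
  haveI := isElliptic_twist
  haveI := isGloballyMinimal_twist
  haveI : Fact (Nat.Prime 3) := ⟨Nat.prime_three⟩
  exact one_le_mordellWeilRank_of_dvd_den _ 3 le_rfl nonsingular_twoP (by norm_num)

/-- **`a₅(E_{-91/9}^{(-4)}) = 1`** (`= 5 + 1 − 5`) and **`5` is a prime of good ordinary reduction of the twist** (`5 ∤ Δ_min`).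
[cite: SilvermanAEC2009, V.2 and VII.5 Prop. 5.1(a)] -/
theorem goodOrdinary_five_twist :
    haveI := isGloballyMinimal_twist
    haveI : Fact (Nat.Prime 5) := ⟨Nat.prime_five⟩
    ((kubertTateFive (((-91 : ℤ) : ℚ)) (((9 : ℤ) : ℚ))).quadraticTwist (-4)).frobeniusTrace 5 = 1 ∧
      ((kubertTateFive (((-91 : ℤ) : ℚ)) (((9 : ℤ) : ℚ))).quadraticTwist (-4)).HasGoodReductionAtPrime 5 := by
  haveI := isGloballyMinimal_twist
  haveI : Fact (Nat.Prime 5) := ⟨Nat.prime_five⟩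
  refine ⟨?_, hasGoodReductionAtPrime_of_not_dvd _ 5 ?_⟩
  · rw [WeierstrassCurve.frobeniusTrace, WeierstrassCurve.reductionPointCount, integralModelInt_twist, natCard_point_five]
    norm_num
  · rw [minimalDiscriminantInt, integralModelInt_twist, Δ_model]; norm_num

/-! ## §3 The door at `5` on the twist, by the class-wide criterion -/

/-- `ω(819) = 3` and `ω₁(819) = 1` (`819 = 3²·7·13`, `13 ≡ 1 (mod 4)`). [folklore] -/
private theorem card_primeFactors :
    (((-91 : ℤ) * 9).natAbs.primeFactors).card = 3 ∧ ((((-91 : ℤ) * 9).natAbs.primeFactors.filter (fun ℓ ↦ ℓ % 4 = 1))).card = 1 := by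
  have e : ((-91 : ℤ) * 9).natAbs = 3 ^ 2 * 7 * 13 := by norm_num
  rw [e, Nat.primeFactors_mul (by norm_num) (by norm_num), Nat.primeFactors_mul (by norm_num) (by norm_num),
    Nat.primeFactors_prime_pow (by norm_num) Nat.prime_three, Nat.Prime.primeFactors (by norm_num : Nat.Prime 7),
    Nat.Prime.primeFactors (by norm_num : Nat.Prime 13)]
  exact ⟨by decide, by decide⟩

/-- **THE THIRD ROW: `rank E_{-91/9}^{(-4)}(ℚ) = 1`, `t₅(E_{-91/9}^{(-4)}/ℚ) = 0`, `t₅(E_{-91/9}/ℚ) = 0` — unconditionally, by descent**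
(class-wide criterion `KubertTateGaussianTwist.twist_door_of_le_rank`: Gaussian-tame, full `ℚ`-box (`rank E(ℚ) = 2 = ω − 1`), and the
twist's rank attains `ω₁ = 1`). The twist has NO rational torsion at all. [cite: SilvermanAEC2009, Thm. X.4.2 and Exercise 10.16]
[cite: Fisher2001FiveSevenDescent, §2] -/
theorem twist_M91_9 :
    haveI := isElliptic_twist
    ((kubertTateFive (((-91 : ℤ) : ℚ)) (((9 : ℤ) : ℚ))).quadraticTwist (-4)).mordellWeilRank = 1 ∧
      ((kubertTateFive (((-91 : ℤ) : ℚ)) (((9 : ℤ) : ℚ))).quadraticTwist (-4)).shaCorank 5 = 0 ∧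
      (kubertTateFive (((-91 : ℤ) : ℚ)) (((9 : ℤ) : ℚ))).shaCorank 5 = 0 := by
  haveI := KubertTateM919Descent.isElliptic
  haveI := isElliptic_twist
  haveI : Fact (Nat.Prime 2) := ⟨Nat.prime_two⟩
  have hP : (kubertTateFive (((-91 : ℤ) : ℚ)) (((9 : ℤ) : ℚ))).toAffine.Nonsingular (-60) 1104 :=
    (KubertTateM919Descent.nonsingular_iff _ _).mpr (by norm_num)
  obtain ⟨hω, hω₁⟩ := card_primeFactors
  have hr : ((-91 : ℤ) * 9).natAbs.primeFactors.card ≤ (kubertTateFive (((-91 : ℤ) : ℚ)) (((9 : ℤ) : ℚ))).mordellWeilRank + 1 := by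
    rw [hω, KubertTateM919Descent.mordellWeilRank_eq]
  have hr' : (((-91 : ℤ) * 9).natAbs.primeFactors.filter (fun ℓ ↦ ℓ % 4 = 1)).card ≤
      ((kubertTateFive (((-91 : ℤ) : ℚ)) (((9 : ℤ) : ℚ))).quadraticTwist (-4)).mordellWeilRank := by
    rw [hω₁]; exact one_le_mordellWeilRank_twist
  obtain ⟨ht, hE, hrk⟩ := KubertTateGaussianTwist.twist_door_of_le_rank (-91) 9 KubertTateM919Descent.not_five_dvd_Δ
    KubertTateM919Descent.gaussian_tame hP (by norm_num) (by norm_num) 2 (by norm_num) (by norm_num)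
    KubertTateM919Descent.not_tor_dvd_Δ hr hr'
  exact ⟨by rw [hrk, hω₁], ht, hE⟩

end KubertTateM919GaussianTwist

end Literature.NumberTheory.EllipticCurves

end
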